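import Summits.QuantumFields.YangMills.Theorems.SwapVirialDeficitSectorLaplaceEndGaussTails
import Summits.QuantumFields.YangMills.Theorems.SwapVirialDeficitSectorLaplaceEndGaussN2Core
import HarnessLib

/-!
# N2 OF `stub_end_gaussCore` IN THE PLUG'S SOCKET SHAPE, MODULO THE PARAMETER CHOICE
# (free-hands support of ⟨stmt-QuantumFields-24197⟩ `SwapVirialDeficit.SwapGluedStiffness`; LEAD g99 — consumer of w3 g68's `endGauss_params`, producer of g49's `hN2`)

`endGauss_N2_of_params`: from the parameter lemma (P) (w3 g68's `endGauss_params`: a window `τ ≤ τw/L^kw` on which `τ ≤ ½` and radii `r, sT, κf` satisfy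
the hypotheses of ✓`endGauss_N2_glue` with `s := √τ` and the three b-free rate floors `τ²/(Q·L^p) ≤ κ_far, κ_1, κ_2`) to the socket `hN2` of g49's plug
`stub_end_gaussCore_of_N2` VERBATIM: `CA = e^{1/2}`, `cA = 0`, `CT = 250000`, `pT = 14 + p`, `QT = Q`, `qT = 2`, `K₁ = 1`, `k₁ = 0`; per point
✓`endGauss_N2_glue` ∘ ✓`gaussCoreIntegrand_le` ∕ ✓`gaussCoreIntegrand_core`, tails by ✓`endGauss_tails_le_of_rates`.

HONEST LABEL: composition; (P) is w3 g68's (pending); the memo-ε plug, `stub_core_tip`, ⟨24197⟩ ∕ ⟨24194⟩ remain OPEN; own crux ⟨22884⟩ OPEN (blocked-on ⟨19935⟩); the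
Yang–Mills mass gap is NOT proved; no summit is proved by a line.  THEOREMS ONLY (0 `def`, 0 `sorry`, no instance), standard axioms.  `--supports stmt-QuantumFields-24197`.
References: [cite: Luscher1983, §2]; [folklore].
-/

set_option autoImplicit false
set_option synthInstance.maxSize 1024

noncomputable section

open MeasureTheory Quaternion Set Module
open scoped Quaternion BigOperators ENNReal InnerProductSpace
open Literature.MathematicalPhysics.QuantumLattice
open Literature.MathematicalPhysics.QuantumFieldTheory hiding SU2

namespace Summit.QuantumFields.YangMills.Theorems.SwapVirialDeficit.SectorLaplace

open Summit.QuantumFields.YangMills.Theorems.FemtoTransferGap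
open Summit.QuantumFields.YangMills.Theorems.FemtoTransferGap.TT
open Summit.QuantumFields.YangMills.Theorems.VirialFluxGap.RingDeficit
open Summit.QuantumFields.YangMills.Theorems.SwapVirialDeficit.SwapRing
open Summit.QuantumFields.YangMills.Theorems.SwapVirialDeficit.BlowUpRing
open Summit.QuantumFields.YangMills.Theorems.SwapVirialDeficit.SigmaBall
open Summit.QuantumFields.YangMills.Theorems.SwapVirialDeficit.Gnomonic (gnomonicWeight piWeight normSq3)

/-- ★★★ **N2 IN THE SOCKET SHAPE OF THE PLUG, modulo the parameter choice (P).** [cite: Luscher1983, §2] -/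
theorem endGauss_N2_of_params
    (hP : ∃ Q : ℝ, 0 < Q ∧ ∃ p : ℕ, ∃ τw : ℝ, 0 < τw ∧ ∃ kw : ℕ, ∀ (L : ℕ) [NeZero L] (τ : ℝ), 0 < τ → τ ≤ τw / (L : ℝ) ^ kw →
      τ ≤ 1 / 2 ∧ ∃ r sT κf : ℝ, 0 < r ∧ r ≤ 1 ∧ 18 * τ ^ 2 ≤ r ^ 2 ∧ 0 ≤ sT ∧
        sT ^ 2 ≤ ((2304 * (L : ℝ) ^ 6 * (Fintype.card (Fol L) : ℝ))⁻¹) ^ 2 / (304992000000 * (L : ℝ) ^ 8) ∧ 0 ≤ κf ∧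
        κf ≤ (2304 * (L : ℝ) ^ 6 * (Fintype.card (Fol L) : ℝ))⁻¹ *
          ((2304 * (L : ℝ) ^ 6 * (Fintype.card (Fol L) : ℝ))⁻¹ / (6 * (2484000 * (L : ℝ) ^ 4))) ^ 2 / 4 ∧
        3219264 * (L : ℝ) ^ 4 * r ≤ (2304 * (L : ℝ) ^ 6 * (Fintype.card (Fol L) : ℝ))⁻¹ / 4 ∧
        3 * (Fintype.card (Fol L) : ℝ) * (3219264 * (L : ℝ) ^ 4 * r) / (2304 * (L : ℝ) ^ 6 * (Fintype.card (Fol L) : ℝ))⁻¹ ≤ 1 / 4 ∧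
        (122689728 * Real.sqrt τ + 44712000 * Real.sqrt (κf / (2304 * (L : ℝ) ^ 6 * (Fintype.card (Fol L) : ℝ))⁻¹)) * (L : ℝ) ^ 4 ≤
          (2304 * (L : ℝ) ^ 6 * (Fintype.card (Fol L) : ℝ))⁻¹ / 4 ∧
        3 * (Fintype.card (Fol L) : ℝ) * ((122689728 * Real.sqrt τ + 44712000 * Real.sqrt (κf / (2304 * (L : ℝ) ^ 6 * (Fintype.card (Fol L) : ℝ))⁻¹)) * (L : ℝ) ^ 4) /
          ((2304 * (L : ℝ) ^ 6 * (Fintype.card (Fol L) : ℝ))⁻¹ / 2) ≤ 1 / 4 ∧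
        τ ^ 2 / (Q * (L : ℝ) ^ p) ≤ 5 / 6 * (min (sT ^ 2) (κf / (300 * (L : ℝ) ^ 4)) / (3600 * (L : ℝ) ^ 6)) ∧
        τ ^ 2 / (Q * (L : ℝ) ^ p) ≤ (2304 * (L : ℝ) ^ 6 * (Fintype.card (Fol L) : ℝ))⁻¹ *
          (3 * ((2304 * (L : ℝ) ^ 6 * (Fintype.card (Fol L) : ℝ))⁻¹ / 2) / (2 * (finrank ℝ (GnoFol L) : ℝ) * (2484000 * (L : ℝ) ^ 4))) ^ 2 / 4 ∧
        τ ^ 2 / (Q * (L : ℝ) ^ p) ≤ 5 / 6 * (min (12 * τ ^ 2) 1 * (r ^ 2 / 18) / (55200 * (L : ℝ) ^ 6))) :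
    ∃ CA : ℝ, 0 < CA ∧ ∃ cA : ℕ, ∃ CT : ℝ, ∃ pT : ℕ, ∃ QT : ℝ, 0 < QT ∧ ∃ qT : ℕ,
      ∃ K₁ : ℝ, 0 < K₁ ∧ ∃ k₁ : ℕ, ∃ τw : ℝ, 0 < τw ∧ ∃ kw : ℕ,
      ∀ (L : ℕ) [NeZero L] (τ : ℝ), 0 < τ → τ ≤ τw / (L : ℝ) ^ kw → ∀ b : ℝ, K₁ * (L : ℝ) ^ k₁ * τ⁻¹ ^ k₁ ≤ b →
      ∀ ε : GnoSign L, GoodSign ε →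
      ∀ AF : GnoCoord L → GnoFol L →ₗ[ℝ] GnoFol L, (∀ η, (AF η).IsSymmetric) →
        (∀ η (y : GnoFol L), ⟪AF η y, y⟫_ℝ =
          iteratedFDeriv ℝ 2 (fun y' : GnoFol L => gnoDeficit z₀ (fun _ => 1) (hubAt 0 1) ε (η + gnoFolEmb y')) 0 (fun _ => y)) →
        (∀ η (y : GnoFol L), ⟪AF η y, y⟫_ℝ = iteratedFDeriv ℝ 2 (gnoDeficit z₀ (fun _ => 1) (hubAt 0 1) ε) η (fun _ => gnoFolEmb y)) →
        (Measurable fun q : GnoCoord L × GnoFol L => ⟪AF q.1 q.2, q.2⟫_ℝ) →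
      ∃ A T : ℝ≥0∞,
        A ≤ ENNReal.ofReal (CA * (L : ℝ) ^ cA *
          (2 * Real.pi / ((1 - 1 / (2 * (finrank ℝ (GnoFol L) : ℝ))) * b)) ^ ((finrank ℝ (GnoFol L) : ℝ) / 2)) ∧
        T ≤ ENNReal.ofReal (Real.exp (CT * (L : ℝ) ^ pT - b * τ ^ qT / (QT * (L : ℝ) ^ pT))) ∧
        ∀ (u : ℝ × ℝ) (t : Fin 3 → ℝ) (v : Fin 2 → ℝ) (z : Fin 3 → ℝ), t 0 ∈ Ioo (-Real.sqrt τ) (Real.sqrt τ) →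
          ∫⁻ F : Fol L → Fin 3 → ℝ,
              ENNReal.ofReal (((1 + (t 0) ^ 2)⁻¹) ^ 2 * gnoDensity ((((![t 1, u.1, u.2] : Fin 3 → ℝ), (![t 2, v 0, v 1] : Fin 3 → ℝ)), (z, F)) : GnoCoord L)) *
                ({p : ℝ × GnoCoord L | 4 * p.1 ^ 2 / (1 + p.1 ^ 2) ^ 2 < τ ∧ τ ≤ (1 + p.1 ^ 2)⁻¹} \
                      ({p : ℝ × GnoCoord L | 4 * p.1 ^ 2 / (1 + p.1 ^ 2) ^ 2 < τ ∧ τ ≤ (1 + p.1 ^ 2)⁻¹ ∧ |p.1| < τ * Real.sqrt (1 + p.1 ^ 2)} ∩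
                        {p : ℝ × GnoCoord L | τ ≤ Real.sqrt (p.2.1.1 1 ^ 2 + p.2.1.1 2 ^ 2)} ∩
                        {p : ℝ × GnoCoord L | |p.2.1.1 0| ≤ 1 * Real.sqrt (1 + p.2.1.1 1 ^ 2 + p.2.1.1 2 ^ 2)}) ∩
                    {p : ℝ × GnoCoord L | p.2.1.1 1 ^ 2 + p.2.1.1 2 ^ 2 ≤ 1 + p.2.1.1 0 ^ 2}).indicator
                  (fun q : ℝ × GnoCoord L => ENNReal.ofReal (Real.exp (-(b * gnoDeficit z₀ (fun _ => 1) (hubAt q.1 1) ε q.2))))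
                  (t 0, ((((![t 1, u.1, u.2] : Fin 3 → ℝ), (![t 2, v 0, v 1] : Fin 3 → ℝ)), (z, F)) : GnoCoord L)) ≤
            (A * ENNReal.ofReal ((Real.sqrt (LinearMap.det (AF (gnoBase (t 1) (t 2)))))⁻¹) + T) *
              ENNReal.ofReal (((1 + t 1 ^ 2 + (u.1 ^ 2 + u.2 ^ 2)) ^ 2)⁻¹ * Real.exp (-(b / (6 * (55200 * (L : ℝ) ^ 6)) *
                (16 * (t 0) ^ 2 / (1 + (t 0) ^ 2) + 8 * (t 1) ^ 2 / ((1 + (t 1) ^ 2) * (1 + (t 0) ^ 2)) + 4 * (t 2) ^ 2 / (1 + (t 2) ^ 2)) *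
                (u.1 ^ 2 + u.2 ^ 2) / (1 + t 1 ^ 2 + (u.1 ^ 2 + u.2 ^ 2))))) *
              ENNReal.ofReal (((1 + t 2 ^ 2 + (v 0 ^ 2 + v 1 ^ 2)) ^ 2)⁻¹ *
                Real.exp (-(b / (6 * (55200 * (L : ℝ) ^ 6)) * (v 0 ^ 2 + v 1 ^ 2) / (1 + t 2 ^ 2 + (v 0 ^ 2 + v 1 ^ 2))))) *
              ENNReal.ofReal (gnomonicWeight z * Real.exp (-(b / (6 * (55200 * (L : ℝ) ^ 6)) * normSq3 z / (1 + normSq3 z)))) := by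
  obtain ⟨Q, hQ, p, τw, hτw, kw, hPL⟩ := hP
  refine ⟨Real.exp (1 / 2), Real.exp_pos _, 0, 250000, 14 + p, Q, hQ, 2, 1, one_pos, 0, τw, hτw, kw, ?_⟩
  intro L _ τ hτ hτle b hb ε hε AF hFs hFyy hamb _hAm
  obtain ⟨hτ2, r, sT, κf, hr0, hr1, hτr, hsT, hs2, hκf0, hκf, hDsmall, hE2, hnear, hE1, ffar, fT1, fT2⟩ := hPL L τ hτ hτle
  have hL : (0 : ℝ) < L := by exact_mod_cast NeZero.pos L
  have hL1 : (1 : ℝ) ≤ L := by exact_mod_cast Nat.one_le_iff_ne_zero.2 (NeZero.ne L)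
  have hb1 : 1 ≤ b := by simpa using hb
  have hb0 : 0 < b := by linarith
  refine ⟨ENNReal.ofReal (Real.exp (1 / 2) * (2 * Real.pi / ((1 - 1 / (2 * (finrank ℝ (GnoFol L) : ℝ))) * b)) ^ ((finrank ℝ (GnoFol L) : ℝ) / 2)), _, ?_, ?_,
    fun u t v z ht0 => endGauss_N2_glue (L := L) hε hFs hFyy hamb hτ hb0 hr0 hr1 hτr hsT hs2 hκf0 hκf hDsmall hE2 hnear hE1 _ u t v z ht0
      (fun F => gaussCoreIntegrand_le (L := L) b ε u t v z F) (gaussCoreIntegrand_core (L := L) hτ hτ2 b ε u t v z)⟩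
  · -- the `A` bound (`cA = 0`)
    rw [pow_zero, mul_one]
  · -- the tails
    set R : ℝ := b * (τ ^ 2 / (Q * (L : ℝ) ^ p)) with hR
    have hfar : R ≤ 5 * b / 6 * (min (sT ^ 2) (κf / (300 * (L : ℝ) ^ 4)) / (3600 * (L : ℝ) ^ 6)) :=
      (mul_le_mul_of_nonneg_left ffar hb0.le).trans (le_of_eq (by ring))
    have hT1 : R ≤ b * ((2304 * (L : ℝ) ^ 6 * (Fintype.card (Fol L) : ℝ))⁻¹ *
        (3 * ((2304 * (L : ℝ) ^ 6 * (Fintype.card (Fol L) : ℝ))⁻¹ / 2) / (2 * (finrank ℝ (GnoFol L) : ℝ) * (2484000 * (L : ℝ) ^ 4))) ^ 2 / 4) :=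
      mul_le_mul_of_nonneg_left fT1 hb0.le
    have hT2 : R ≤ 5 * b / 6 * (min (12 * τ ^ 2) 1 * (r ^ 2 / 18) / (55200 * (L : ℝ) ^ 6)) :=
      (mul_le_mul_of_nonneg_left fT2 hb0.le).trans (le_of_eq (by ring))
    refine (endGauss_tails_le_of_rates (L := L) hb1 hfar hT1 hT2).trans (ENNReal.ofReal_le_ofReal (Real.exp_le_exp.2 ?_))
    have h1 : (250000 : ℝ) * (L : ℝ) ^ 14 ≤ 250000 * (L : ℝ) ^ (14 + p) := by
      exact mul_le_mul_of_nonneg_left (pow_le_pow_right₀ hL1 (Nat.le_add_right 14 p)) (by norm_num)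
    have h2 : b * τ ^ 2 / (Q * (L : ℝ) ^ (14 + p)) ≤ R := by
      rw [hR, ← mul_div_assoc]
      refine div_le_div_of_nonneg_left (by positivity) (by positivity) ?_
      exact mul_le_mul_of_nonneg_left (pow_le_pow_right₀ hL1 (Nat.le_add_left p 14)) hQ.le
    linarith

end Summit.QuantumFields.YangMills.Theorems.SwapVirialDeficit.SectorLaplace

end
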